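import Summits.QuantumFields.BalabanUV.Beta.GAN24.T2DevCovariance
import Summits.QuantumFields.BalabanUV.Beta.GAN24.Lin4ZeroMode

/-!
# `BalabanUV.Beta.GAN24.T2DevShapes` — binder row G-an2-4 / (CONV-C), W-slot CT-W, route (R-DEV) (RULING R-gan24p1-g23-1 l.37889; R-gan24p1-g23-3 l.38256): **PER-LEVEL SHAPES OF THE
# DEVIATION `D_j = T̃_j − T_j` AND OF THE OWNER's FORCING `g′_j`, THE DEVIATION's AFFINE STEP AT THE COMB LITERALS, AND ITS EXACT CHARGE LEDGER**
# `zmode N (D_{j+1}) = N^{d+1}·c₄·½σ⁴·zmodeSym_{Lc}(𝔇 D_j) + zmode N (g′_j)` (no hypothesis beyond the border) — the identity in which R4's «compensated ONLY in the total» lives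

NOT IN PRINT; OUR BOOKKEEPING ([folklore] an2's `T2RecAt_loc_of_slot` ∕ `T2RecOf_loc` + leaf-08's `locStencil₂_unitS₂`, `Lin4ZeroMode.locStencil₂_lin4`, leaf-12's `locStencil₂_sub`, the OWNER's
`locStencil₂_add`, `T2RecAt_zero_level` ∕ `T2RecOf_zero_level`, `lin4_add_of_bdd₄`, leaf-19's `zmode_add ∕ zmode_sub`, this lineage's `T2DevCovariance` + `DressedStepCharge`; G-an2-4
formalisation swarm, leaf prover `b2b-balaban-gan24-formalise-leaf-01`, gen 62; «MINE (W4)» l.37955 ∕ l.38062, RE-POINTED per RULING R-gan24p1-g23-3 (journal l.38282): the (Z′)-conditional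
`hZ0` item is WITHDRAWN, the unconditional shapes ∕ step ∕ charge ledger kept; name PROVISIONAL).  HONEST FRAMING (cell contract, verbatim): «discharging `BetaPertH` makes Bałaban's
UV stability UNCONDITIONAL — a real constructive-QFT result; it is NOT the continuum limit and NOT the Clay problem.»  HONEST DEPENDENCY (verbatim): «continuum YM on T⁴ ⇐ BetaPertH ∧ nine
spine estimates (0/9 proved); BetaPertH ⇐ (D1) ∧ (D4) ∧ CAP+tail; G-an2-4 gates asym, D1 and NE2/3/4.»

## Objects (generic `d`; `Lc` a `NeZero`, `1 ≤ Lc`; in-block root `r ∈ box (d+1) Lc`; `T̃_j := unitS₂_j (T2RecAt d Lc ρ cE cVH cΛ cE₂ cB Tc vh₂S (mixFFAt ρ Lc) j)`,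
## `T_j := unitS₂_j (T2RecOf d Lc (KInvStep Lc ·) (SpureRecAt ρ …) (M1At ρ cΛ) cE₂ cB Tc vh₂S (mixFFAt ρ Lc) j)` (the OWNER's undressed-kernel comb-slot tower), `D_j := T̃_j − T_j`,
## `g′_j` the OWNER's forcing literal of `T2DeviationTower.unitS₂_T2RecAt_dev_eq_sum` VERBATIM, `𝒜^E_j := lin4 c₄ (unitK_j (coDressKBmAt ρ Lc (KInvStep Lc j))) Lc`,
## `𝔇X κ u κ′ u′ := dressKBmAt ρ Lc (coProjBmAtK ρ Lc (κ₁ u₁ ↦ coProjBmAtK ρ Lc (X κ₁ u₁) κ′ u′) κ u)`; off-diagonal `LocStencil₂` border `vh₂S`, joint covariance `hBt` displayed where used)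
* §0 `locStencil₂_lin4_dressed`, `lin4_dressed_zero` (generic helpers on the dressed step).
* §3 `exists_locStencil₂_towers`, **`exists_locStencil₂_dev_comb`**, **`exists_locStencil₂_gprime_comb`** (per-level `LocStencil₂` shapes at a positive rate).
* §4 `dev_comb_zero` (`D_0 = 0`), **`dev_comb_succ`** (`D_{j+1} = 𝒜^E_j D_j + g′_j`, every `j` — the comb instance of the OWNER's slotted `unitS₂_T2RecOf_dev_succ_of_letters`).
* §5 **`zmode_dev_succ`** (the exact charge step above), **`zmode_dev_eq_zero_iff_conserved`** (`zmode N (D_j) = 0 ↔ zmode N (T̃_j) = zmode N (T_j)`).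
Asserts NO shape of Bałaban's tables and NO value of any charge; discharges NOTHING of (C) ∕ «T2Shape» ∕ «T2Drift» ∕ (hW, hWall); NOT «W-slot closed», NEVER «G-an2-4 closed» as (CONV-C); NOT D1,
NOT `BetaPertH`, NOT continuum, NOT Clay.  0 cited facts, 0 `def`, 0 `def … : Prop`, 0 sorry.
-/

noncomputable section

open Finset
open scoped BigOperators
open Literature.MathematicalPhysics.QuantumFieldTheory
open Literature.MathematicalPhysics.QuantumFieldTheory.Balaban1983to89
open Literature.MathematicalPhysics.QuantumFieldTheory.Balaban1983to89.Beta
open ExpKernelCalculus (MKer Decays BiLoc VertexFamily VertexFamily₂ shiftK)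
open OneStepResolventKernel (Fib LocStencil decays_mono)
open OneStepKernelFamily (KInvStep decays_KInvStep shiftK_KInvStep)
open AffineAveraging (box toSite)
open AveragingMixedJetTables (mixFFAt mixFFAt_translate)
open SecondOrderResponse (W2SymOfK LocStencilFM)
open BalabanCompositeJets (LocStencil₂)
open BalabanStepJetsSucc (mmRead)
open BalabanStepW2 (K3OfK M2Of)
open Summit.QuantumFields.BalabanUV.Beta.HessKerDressedUnits (unitK unitS decays_unitK)
open Summit.QuantumFields.BalabanUV.Beta.SecondOrderUnits (unitM unitS₂ unitM₂)
open Summit.QuantumFields.BalabanUV.Beta.AxialDressingRooted (coDressKBmAt dressKBmAt coProjBmAtK decays_coDressKBmAt_KInvStep)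
open Summit.QuantumFields.BalabanUV.Beta.SpineRooted (T2RecOf T2RecAt SpureRecAt M1At T2RecOf_comb T2RecOf_loc T2RecOf_translate T2RecAt_translate T2RecAt_loc_of_slot
  T2RecOf_zero_level T2RecAt_zero_level locStencil_SpureRecAt vertexFamily_M1At SpureRecAt_translate M1At_translate)
open Summit.QuantumFields.BalabanUV.Beta.MixedJetTablesPlug (hmix_an1)
open Summit.QuantumFields.BalabanUV.Beta.GAN24.CombesThomas (sfStep smStep)
open Summit.QuantumFields.BalabanUV.Beta.GAN24.T2RecursionAffine (lin4)
open Summit.QuantumFields.BalabanUV.Beta.GAN24.BiStencilZeroMode (Tab zmode)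
open Summit.QuantumFields.BalabanUV.Beta.GAN24.T2SlotCovariance (unitS₂_translate)
open Summit.QuantumFields.BalabanUV.Beta.GAN24.WSlotFirstDiff (locStencil₂_unitS₂)
open Summit.QuantumFields.BalabanUV.Beta.GAN24.WSlotForcingZeroMode (locStencil₂_sub)
open Summit.QuantumFields.BalabanUV.Beta.GAN24.WSlotT2OfPieces (locStencil₂_add)
open Summit.QuantumFields.BalabanUV.Beta.GAN24.WSlotForcingZeroModeW3 (add_translate_pi sub_translate_pi)
open Summit.QuantumFields.BalabanUV.Beta.GAN24.Lin4ZeroMode (lin4_translate shiftK_unitKInvStep locStencil₂_lin4)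
open Summit.QuantumFields.BalabanUV.Beta.GAN24.T2RecOfUnitSplit (unitS₂_T2RecOf_succ_eq_lin4_add step_data_of_letters)
open Summit.QuantumFields.BalabanUV.Beta.GAN24.DressedStepCharge (lin4_dressed_translate zmode_lin4_dressed_step locStencil₂_dressTab dressTab_translate)
open Summit.QuantumFields.BalabanUV.Beta.GAN24.WSlotFirstDiff (zmode_add zmode_sub)
open Summit.QuantumFields.BalabanUV.Beta.GAN24.T2UnitSplitLevels (bdd₄_zero bdd₄_sub lin4_add_of_bdd₄)
open Summit.QuantumFields.BalabanUV.Beta.GAN24.T2UnitSplitShapes (bdd₄_of_locStencil₂)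

open Summit.QuantumFields.BalabanUV.Beta.GAN24.T2DevCovariance

namespace Summit.QuantumFields.BalabanUV.Beta.GAN24.T2DevShapes

variable {d : ℕ} {Lc : ℕ} [NeZero Lc] {r : Fin (d + 1) → ℕ}

/-! ## §0 Two generic helpers on the dressed comb step -/

/-- [folklore] **THE DRESSED COMB STEP OF A `LocStencil₂` TABLE IS `LocStencil₂`** (some constant, rate `min m δ ∕ 128 ≤ δ` with `m` the dressed resolvent's rate):
`Lin4ZeroMode.locStencil₂_lin4` at the dressed unit kernel (asym1's `decays_coDressKBmAt_KInvStep`, `decays_unitK`). -/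
theorem locStencil₂_lin4_dressed (hr : r ∈ box (d + 1) Lc) (j : ℕ) (c : ℝ) {X : Tab d} {C δ : ℝ} (hX : LocStencil₂ X C δ) (hδ : 0 < δ) :
    ∃ C' δ' : ℝ, 0 < δ' ∧ δ' ≤ δ ∧
      LocStencil₂ (lin4 c (unitK (sfStep Lc j) (smStep d Lc j) (coDressKBmAt (toSite r) Lc (KInvStep (d := d) Lc j))) Lc X) C' δ' := by
  have hLc : 1 ≤ Lc := Nat.one_le_iff_ne_zero.mpr (NeZero.ne Lc)
  obtain ⟨m, CK, hm, hCK, hK⟩ := decays_coDressKBmAt_KInvStep (d := d) hr j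
  have hKu := decays_unitK (sf := sfStep Lc j) (sm := smStep d Lc j) hK
  have h := locStencil₂_lin4 hKu (by positivity) hm hLc c hX hδ
  refine ⟨_, min m δ / 128, by positivity, ?_, h⟩
  have : min m δ ≤ δ := min_le_right _ _
  linarith [hδ, hm, le_min hm.le hδ.le]

/-- [folklore] **THE DRESSED COMB STEP KILLS THE ZERO TABLE** (additivity on the bounded class). -/
theorem lin4_dressed_zero (hr : r ∈ box (d + 1) Lc) (j : ℕ) (c : ℝ) :
    lin4 c (unitK (sfStep Lc j) (smStep d Lc j) (coDressKBmAt (toSite r) Lc (KInvStep (d := d) Lc j))) Lc (0 : Tab d) = 0 := by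
  obtain ⟨m, CK, hm, -, hK⟩ := decays_coDressKBmAt_KInvStep (d := d) hr j
  have hKu := decays_unitK (sf := sfStep Lc j) (sm := smStep d Lc j) hK
  have h := lin4_add_of_bdd₄ hKu hm c Lc (bdd₄_zero (d := d)) (bdd₄_zero (d := d))
  rw [add_zero] at h
  have := congrArg (fun Y => Y - lin4 c (unitK (sfStep Lc j) (smStep d Lc j) (coDressKBmAt (toSite r) Lc (KInvStep (d := d) Lc j))) Lc 0) h
  exact (by simpa using this : (0 : Tab d) = _).symm

/-! ## §3 Per-level shapes of the deviation and of the forcing -/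

/-- [folklore] Both unit towers are `LocStencil₂` at a common positive rate, per level (an2's `T2RecAt_loc_of_slot` ∕ `T2RecOf_loc` + leaf-08's `locStencil₂_unitS₂`; rates merged by `min`). -/
theorem exists_locStencil₂_towers (hLc : 1 ≤ Lc) (hr : r ∈ box (d + 1) Lc) (cE cVH cΛ cE₂ cB : ℝ) (Tc : Fin 4 → Fin 4 → Fin 4 → Fin 4 → ℝ)
    {vh₂S : Tab d} (hB : ∃ C δ : ℝ, 0 < δ ∧ LocStencil₂ vh₂S C δ) (j : ℕ) :
    ∃ C C' δ : ℝ, 0 < δ ∧ LocStencil₂ (unitS₂ (sfStep Lc j) (smStep d Lc j) (T2RecAt d Lc (toSite r) cE cVH cΛ cE₂ cB Tc vh₂S (mixFFAt (toSite r) Lc) j)) C δ ∧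
      LocStencil₂ (unitS₂ (sfStep Lc j) (smStep d Lc j) (T2RecOf d Lc (fun j => KInvStep (d := d) Lc j) (SpureRecAt d Lc (toSite r) cE cVH cΛ) (M1At d Lc (toSite r) cΛ) cE₂ cB Tc vh₂S (mixFFAt (toSite r) Lc) j)) C' δ := by
  obtain ⟨C₁, δ₁, hδ₁, h₁⟩ := T2RecAt_loc_of_slot (cE := cE) (cVH := cVH) (cΛ := cΛ) (cE₂ := cE₂) (cB := cB) (T := Tc) (vh₂S := vh₂S)
    (mixFF := mixFFAt (toSite r) Lc) hLc hr hB (hmix_an1 hLc hr) j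
  obtain ⟨C₂, δ₂, hδ₂, h₂⟩ := T2RecOf_loc (G := fun j => KInvStep (d := d) Lc j) (S := SpureRecAt d Lc (toSite r) cE cVH cΛ) (M := M1At d Lc (toSite r) cΛ)
    (cE₂ := cE₂) (cB := cB) (T := Tc) (vh₂S := vh₂S) (mixFF := mixFFAt (toSite r) Lc) hLc (fun j => decays_KInvStep (d := d) (Lc := Lc) j) (fun j => locStencil_SpureRecAt hLc hr cE cVH cΛ j)
    (fun j => ⟨_, 1, one_pos, vertexFamily_M1At hLc hr cΛ j zero_le_one⟩) hB (hmix_an1 hLc hr) j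
  exact ⟨_, _, min δ₁ δ₂, lt_min hδ₁ hδ₂, (locStencil₂_unitS₂ _ _ h₁).mono (min_le_left _ _), (locStencil₂_unitS₂ _ _ h₂).mono (min_le_right _ _)⟩

/-- [folklore] **THE DEVIATION MEMBERS ARE `LocStencil₂`**, per level. -/
theorem exists_locStencil₂_dev_comb (hLc : 1 ≤ Lc) (hr : r ∈ box (d + 1) Lc) (cE cVH cΛ cE₂ cB : ℝ) (Tc : Fin 4 → Fin 4 → Fin 4 → Fin 4 → ℝ)
    {vh₂S : Tab d} (hB : ∃ C δ : ℝ, 0 < δ ∧ LocStencil₂ vh₂S C δ) (j : ℕ) :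
    ∃ C δ : ℝ, 0 < δ ∧ LocStencil₂ ((fun j => (unitS₂ (sfStep Lc j) (smStep d Lc j) (T2RecAt d Lc (toSite r) cE cVH cΛ cE₂ cB Tc vh₂S (mixFFAt (toSite r) Lc) j))
      - (unitS₂ (sfStep Lc j) (smStep d Lc j) (T2RecOf d Lc (fun j => KInvStep (d := d) Lc j) (SpureRecAt d Lc (toSite r) cE cVH cΛ) (M1At d Lc (toSite r) cΛ) cE₂ cB Tc vh₂S (mixFFAt (toSite r) Lc) j))) j) C δ := by
  obtain ⟨C, C', δ, hδ, h₁, h₂⟩ := exists_locStencil₂_towers hLc hr cE cVH cΛ cE₂ cB Tc hB j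
  exact ⟨_, δ, hδ, locStencil₂_sub h₁ h₂⟩

/-- [folklore] **THE OWNER's FORCING `g′_j` IS `LocStencil₂`**, per level (the two steps of the undressed member: `T2DevForcingZeroMode.locStencil₂_lin4_dressed` ∕
`Lin4ZeroMode.locStencil₂_lin4`; the two sources as `T_{j+1} − 𝒜_j T_j`; `locStencil₂_sub`, leaf-18's `add` through `sub` of a negative). -/
theorem exists_locStencil₂_gprime_comb (hLc : 1 ≤ Lc) (hr : r ∈ box (d + 1) Lc) (cE cVH cΛ cE₂ cB : ℝ) (Tc : Fin 4 → Fin 4 → Fin 4 → Fin 4 → ℝ)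
    {vh₂S : Tab d}
    (hBff : ∀ κ u κ' u' x z (α β : Fin (d + 1)), vh₂S κ u κ' u' x z (Sum.inl α) (Sum.inl β) = 0)
    (hBmm : ∀ κ u κ' u' x z (μ ν : Fin (d + 1)), vh₂S κ u κ' u' x z (Sum.inr μ) (Sum.inr ν) = 0)
    (hB : ∃ C δ : ℝ, 0 < δ ∧ LocStencil₂ vh₂S C δ) (i : ℕ) :
    ∃ C δ : ℝ, 0 < δ ∧ LocStencil₂ (((lin4 (cE₂ * (Lc : ℝ) ^ (2 * (d + 1))) (unitK (sfStep Lc i) (smStep d Lc i) (coDressKBmAt (toSite r) Lc (KInvStep (d := d) Lc i))) Lc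
            (unitS₂ (sfStep Lc i) (smStep d Lc i) (T2RecOf d Lc (fun j => KInvStep (d := d) Lc j) (SpureRecAt d Lc (toSite r) cE cVH cΛ) (M1At d Lc (toSite r) cΛ) cE₂ cB Tc vh₂S (mixFFAt (toSite r) Lc) i)) -
          lin4 (cE₂ * (Lc : ℝ) ^ (2 * (d + 1))) (unitK (sfStep Lc i) (smStep d Lc i) (KInvStep (d := d) Lc i)) Lc
            (unitS₂ (sfStep Lc i) (smStep d Lc i) (T2RecOf d Lc (fun j => KInvStep (d := d) Lc j) (SpureRecAt d Lc (toSite r) cE cVH cΛ) (M1At d Lc (toSite r) cΛ) cE₂ cB Tc vh₂S (mixFFAt (toSite r) Lc) i))) +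
        ((fun κ u κ' u' => (cE₂ * (Lc : ℝ) ^ (2 * (d + 1))) • mmRead Lc (K3OfK (unitK (sfStep Lc i) (smStep d Lc i) (coDressKBmAt (toSite r) Lc (KInvStep (d := d) Lc i))) Lc
            (unitS (sfStep Lc i) (smStep d Lc i) (SpureRecAt d Lc (toSite r) cE cVH cΛ i)) (unitM (sfStep Lc i) (smStep d Lc i) (M1At d Lc (toSite r) cΛ i))
            (W2SymOfK (unitK (sfStep Lc i) (smStep d Lc i) (coDressKBmAt (toSite r) Lc (KInvStep (d := d) Lc i))) Lc (unitS (sfStep Lc i) (smStep d Lc i) (SpureRecAt d Lc (toSite r) cE cVH cΛ i))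
              (unitM (sfStep Lc i) (smStep d Lc i) (M1At d Lc (toSite r) cΛ i)) 0 (unitM₂ (sfStep Lc i) (smStep d Lc i) (M2Of d Lc (mixFFAt (toSite r) Lc) i))) κ u κ' u')
          + cB • vh₂S κ u κ' u') -
         (fun κ u κ' u' => (cE₂ * (Lc : ℝ) ^ (2 * (d + 1))) • mmRead Lc (K3OfK (unitK (sfStep Lc i) (smStep d Lc i) (KInvStep (d := d) Lc i)) Lc
            (unitS (sfStep Lc i) (smStep d Lc i) (SpureRecAt d Lc (toSite r) cE cVH cΛ i)) (unitM (sfStep Lc i) (smStep d Lc i) (M1At d Lc (toSite r) cΛ i))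
            (W2SymOfK (unitK (sfStep Lc i) (smStep d Lc i) (KInvStep (d := d) Lc i)) Lc (unitS (sfStep Lc i) (smStep d Lc i) (SpureRecAt d Lc (toSite r) cE cVH cΛ i))
              (unitM (sfStep Lc i) (smStep d Lc i) (M1At d Lc (toSite r) cΛ i)) 0 (unitM₂ (sfStep Lc i) (smStep d Lc i) (M2Of d Lc (mixFFAt (toSite r) Lc) i))) κ u κ' u')
          + cB • vh₂S κ u κ' u')))) C δ := by
  obtain ⟨C₀, C₀', δ₀, hδ₀, hE₀, hK₀⟩ := exists_locStencil₂_towers hLc hr cE cVH cΛ cE₂ cB Tc hB i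
  obtain ⟨C₁, C₁', δ₁, hδ₁, hE₁, hK₁⟩ := exists_locStencil₂_towers hLc hr cE cVH cΛ cE₂ cB Tc hB (i + 1)
  -- the two steps on the undressed member
  obtain ⟨Ca, δa, hδa, -, ha⟩ := locStencil₂_lin4_dressed hr i (cE₂ * (Lc : ℝ) ^ (2 * (d + 1))) hK₀ hδ₀
  obtain ⟨m, CK, hm, hCK, hK⟩ := decays_KInvStep (d := d) (Lc := Lc) i
  obtain ⟨Cb, hb⟩ : ∃ C : ℝ, LocStencil₂ (lin4 (cE₂ * (Lc : ℝ) ^ (2 * (d + 1))) (unitK (sfStep Lc i) (smStep d Lc i) (KInvStep (d := d) Lc i)) Lc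
      (unitS₂ (sfStep Lc i) (smStep d Lc i) (T2RecOf d Lc (fun j => KInvStep (d := d) Lc j) (SpureRecAt d Lc (toSite r) cE cVH cΛ) (M1At d Lc (toSite r) cΛ) cE₂ cB Tc vh₂S (mixFFAt (toSite r) Lc) i))) C (min m δ₀ / 128) :=
    ⟨_, locStencil₂_lin4 (decays_unitK (sf := sfStep Lc i) (sm := smStep d Lc i) hK) (by positivity) hm hLc (cE₂ * (Lc : ℝ) ^ (2 * (d + 1))) hK₀ hδ₀⟩
  -- the two steps on the dressed ∕ undressed members (for the sources)
  obtain ⟨Cc, δc, hδc, -, hc⟩ := locStencil₂_lin4_dressed hr i (cE₂ * (Lc : ℝ) ^ (2 * (d + 1))) hE₀ hδ₀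
  have esG : (fun κ u κ' u' => (cE₂ * (Lc : ℝ) ^ (2 * (d + 1))) • mmRead Lc (K3OfK (unitK (sfStep Lc i) (smStep d Lc i) (coDressKBmAt (toSite r) Lc (KInvStep (d := d) Lc i))) Lc
            (unitS (sfStep Lc i) (smStep d Lc i) (SpureRecAt d Lc (toSite r) cE cVH cΛ i)) (unitM (sfStep Lc i) (smStep d Lc i) (M1At d Lc (toSite r) cΛ i))
            (W2SymOfK (unitK (sfStep Lc i) (smStep d Lc i) (coDressKBmAt (toSite r) Lc (KInvStep (d := d) Lc i))) Lc (unitS (sfStep Lc i) (smStep d Lc i) (SpureRecAt d Lc (toSite r) cE cVH cΛ i))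
              (unitM (sfStep Lc i) (smStep d Lc i) (M1At d Lc (toSite r) cΛ i)) 0 (unitM₂ (sfStep Lc i) (smStep d Lc i) (M2Of d Lc (mixFFAt (toSite r) Lc) i))) κ u κ' u')
          + cB • vh₂S κ u κ' u') =
      (unitS₂ (sfStep Lc (i + 1)) (smStep d Lc (i + 1)) (T2RecAt d Lc (toSite r) cE cVH cΛ cE₂ cB Tc vh₂S (mixFFAt (toSite r) Lc) (i + 1))) -
      lin4 (cE₂ * (Lc : ℝ) ^ (2 * (d + 1))) (unitK (sfStep Lc i) (smStep d Lc i) (coDressKBmAt (toSite r) Lc (KInvStep (d := d) Lc i))) Lc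
        (unitS₂ (sfStep Lc i) (smStep d Lc i) (T2RecAt d Lc (toSite r) cE cVH cΛ cE₂ cB Tc vh₂S (mixFFAt (toSite r) Lc) i)) := by
    rw [succ_comb_dressed hLc hr cE cVH cΛ cE₂ cB Tc hBff hBmm hB i, add_sub_cancel_left]
  have esK : (fun κ u κ' u' => (cE₂ * (Lc : ℝ) ^ (2 * (d + 1))) • mmRead Lc (K3OfK (unitK (sfStep Lc i) (smStep d Lc i) (KInvStep (d := d) Lc i)) Lc
            (unitS (sfStep Lc i) (smStep d Lc i) (SpureRecAt d Lc (toSite r) cE cVH cΛ i)) (unitM (sfStep Lc i) (smStep d Lc i) (M1At d Lc (toSite r) cΛ i))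
            (W2SymOfK (unitK (sfStep Lc i) (smStep d Lc i) (KInvStep (d := d) Lc i)) Lc (unitS (sfStep Lc i) (smStep d Lc i) (SpureRecAt d Lc (toSite r) cE cVH cΛ i))
              (unitM (sfStep Lc i) (smStep d Lc i) (M1At d Lc (toSite r) cΛ i)) 0 (unitM₂ (sfStep Lc i) (smStep d Lc i) (M2Of d Lc (mixFFAt (toSite r) Lc) i))) κ u κ' u')
          + cB • vh₂S κ u κ' u') =
      (unitS₂ (sfStep Lc (i + 1)) (smStep d Lc (i + 1)) (T2RecOf d Lc (fun j => KInvStep (d := d) Lc j) (SpureRecAt d Lc (toSite r) cE cVH cΛ) (M1At d Lc (toSite r) cΛ) cE₂ cB Tc vh₂S (mixFFAt (toSite r) Lc) (i + 1))) -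
      lin4 (cE₂ * (Lc : ℝ) ^ (2 * (d + 1))) (unitK (sfStep Lc i) (smStep d Lc i) (KInvStep (d := d) Lc i)) Lc
        (unitS₂ (sfStep Lc i) (smStep d Lc i) (T2RecOf d Lc (fun j => KInvStep (d := d) Lc j) (SpureRecAt d Lc (toSite r) cE cVH cΛ) (M1At d Lc (toSite r) cΛ) cE₂ cB Tc vh₂S (mixFFAt (toSite r) Lc) i)) := by
    rw [succ_comb_undressed hLc hr cE cVH cΛ cE₂ cB Tc hBff hBmm hB i, add_sub_cancel_left]
  set rr : ℝ := min (min δa (min m δ₀ / 128)) (min δ₁ δc) with hrr_def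
  have hrr : 0 < rr := by rw [hrr_def]; positivity
  have r1 : rr ≤ δa := by rw [hrr_def]; exact (min_le_left _ _).trans (min_le_left _ _)
  have r2 : rr ≤ min m δ₀ / 128 := by rw [hrr_def]; exact (min_le_left _ _).trans (min_le_right _ _)
  have r3 : rr ≤ δ₁ := by rw [hrr_def]; exact (min_le_right _ _).trans (min_le_left _ _)
  have r4 : rr ≤ δc := by rw [hrr_def]; exact (min_le_right _ _).trans (min_le_right _ _)
  have hsG : LocStencil₂ (fun κ u κ' u' => (cE₂ * (Lc : ℝ) ^ (2 * (d + 1))) • mmRead Lc (K3OfK (unitK (sfStep Lc i) (smStep d Lc i) (coDressKBmAt (toSite r) Lc (KInvStep (d := d) Lc i))) Lc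
            (unitS (sfStep Lc i) (smStep d Lc i) (SpureRecAt d Lc (toSite r) cE cVH cΛ i)) (unitM (sfStep Lc i) (smStep d Lc i) (M1At d Lc (toSite r) cΛ i))
            (W2SymOfK (unitK (sfStep Lc i) (smStep d Lc i) (coDressKBmAt (toSite r) Lc (KInvStep (d := d) Lc i))) Lc (unitS (sfStep Lc i) (smStep d Lc i) (SpureRecAt d Lc (toSite r) cE cVH cΛ i))
              (unitM (sfStep Lc i) (smStep d Lc i) (M1At d Lc (toSite r) cΛ i)) 0 (unitM₂ (sfStep Lc i) (smStep d Lc i) (M2Of d Lc (mixFFAt (toSite r) Lc) i))) κ u κ' u')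
          + cB • vh₂S κ u κ' u') (C₁ + |(-1 : ℝ)| * Cc) rr := by
    rw [esG]; exact locStencil₂_sub (hE₁.mono r3) (hc.mono r4)
  have hsK : LocStencil₂ (fun κ u κ' u' => (cE₂ * (Lc : ℝ) ^ (2 * (d + 1))) • mmRead Lc (K3OfK (unitK (sfStep Lc i) (smStep d Lc i) (KInvStep (d := d) Lc i)) Lc
            (unitS (sfStep Lc i) (smStep d Lc i) (SpureRecAt d Lc (toSite r) cE cVH cΛ i)) (unitM (sfStep Lc i) (smStep d Lc i) (M1At d Lc (toSite r) cΛ i))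
            (W2SymOfK (unitK (sfStep Lc i) (smStep d Lc i) (KInvStep (d := d) Lc i)) Lc (unitS (sfStep Lc i) (smStep d Lc i) (SpureRecAt d Lc (toSite r) cE cVH cΛ i))
              (unitM (sfStep Lc i) (smStep d Lc i) (M1At d Lc (toSite r) cΛ i)) 0 (unitM₂ (sfStep Lc i) (smStep d Lc i) (M2Of d Lc (mixFFAt (toSite r) Lc) i))) κ u κ' u')
          + cB • vh₂S κ u κ' u') (C₁' + |(-1 : ℝ)| * Cb) rr := by
    rw [esK]; exact locStencil₂_sub (hK₁.mono r3) (hb.mono r2)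
  exact ⟨_, rr, hrr, locStencil₂_add (locStencil₂_sub (ha.mono r1) (hb.mono r2)) (locStencil₂_sub hsG hsK)⟩

/-! ## §4 The deviation's recursion at the comb literals: `D_0 = 0`, `D_{j+1} = 𝒜^E_j D_j + g′_j` -/

/-- [folklore] **THE DEVIATION STARTS AT ZERO**: `D_0 = 0` (both towers' member `0` is the slot-free initial table: `T2RecAt_zero_level`, `T2RecOf_zero_level`). -/
theorem dev_comb_zero (cE cVH cΛ cE₂ cB : ℝ) (Tc : Fin 4 → Fin 4 → Fin 4 → Fin 4 → ℝ) {vh₂S : Tab d} :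
    (fun j => (unitS₂ (sfStep Lc j) (smStep d Lc j) (T2RecAt d Lc (toSite r) cE cVH cΛ cE₂ cB Tc vh₂S (mixFFAt (toSite r) Lc) j))
      - (unitS₂ (sfStep Lc j) (smStep d Lc j) (T2RecOf d Lc (fun j => KInvStep (d := d) Lc j) (SpureRecAt d Lc (toSite r) cE cVH cΛ) (M1At d Lc (toSite r) cΛ) cE₂ cB Tc vh₂S (mixFFAt (toSite r) Lc) j))) 0 = 0 := by
  show (unitS₂ (sfStep Lc 0) (smStep d Lc 0) (T2RecAt d Lc (toSite r) cE cVH cΛ cE₂ cB Tc vh₂S (mixFFAt (toSite r) Lc) 0)) - (unitS₂ (sfStep Lc 0) (smStep d Lc 0) (T2RecOf d Lc (fun j => KInvStep (d := d) Lc j) (SpureRecAt d Lc (toSite r) cE cVH cΛ) (M1At d Lc (toSite r) cΛ) cE₂ cB Tc vh₂S (mixFFAt (toSite r) Lc) 0)) = 0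
  rw [T2RecAt_zero_level, T2RecOf_zero_level, sub_self]

/-- NOT IN PRINT; OUR BOOKKEEPING ([folklore] the two comb steps `T2DevCovariance.succ_comb_dressed ∕ _undressed` + additivity of `𝒜^E_j` on bounded tables; the comb
instance of the OWNER's slotted `T2DeviationTower.unitS₂_T2RecOf_dev_succ_of_letters`).  **THE DEVIATION's AFFINE STEP**: `D_{j+1} = 𝒜^E_j D_j + g′_j`, every `j`, with the OWNER's `g′_j`. -/
theorem dev_comb_succ (hLc : 1 ≤ Lc) (hr : r ∈ box (d + 1) Lc) (cE cVH cΛ cE₂ cB : ℝ) (Tc : Fin 4 → Fin 4 → Fin 4 → Fin 4 → ℝ)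
    {vh₂S : Tab d}
    (hBff : ∀ κ u κ' u' x z (α β : Fin (d + 1)), vh₂S κ u κ' u' x z (Sum.inl α) (Sum.inl β) = 0)
    (hBmm : ∀ κ u κ' u' x z (μ ν : Fin (d + 1)), vh₂S κ u κ' u' x z (Sum.inr μ) (Sum.inr ν) = 0)
    (hB : ∃ C δ : ℝ, 0 < δ ∧ LocStencil₂ vh₂S C δ) (j : ℕ) :
    (fun j => (unitS₂ (sfStep Lc j) (smStep d Lc j) (T2RecAt d Lc (toSite r) cE cVH cΛ cE₂ cB Tc vh₂S (mixFFAt (toSite r) Lc) j))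
      - (unitS₂ (sfStep Lc j) (smStep d Lc j) (T2RecOf d Lc (fun j => KInvStep (d := d) Lc j) (SpureRecAt d Lc (toSite r) cE cVH cΛ) (M1At d Lc (toSite r) cΛ) cE₂ cB Tc vh₂S (mixFFAt (toSite r) Lc) j))) (j + 1) =
      lin4 (cE₂ * (Lc : ℝ) ^ (2 * (d + 1))) (unitK (sfStep Lc j) (smStep d Lc j) (coDressKBmAt (toSite r) Lc (KInvStep (d := d) Lc j))) Lc ((fun j => (unitS₂ (sfStep Lc j) (smStep d Lc j) (T2RecAt d Lc (toSite r) cE cVH cΛ cE₂ cB Tc vh₂S (mixFFAt (toSite r) Lc) j))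
      - (unitS₂ (sfStep Lc j) (smStep d Lc j) (T2RecOf d Lc (fun j => KInvStep (d := d) Lc j) (SpureRecAt d Lc (toSite r) cE cVH cΛ) (M1At d Lc (toSite r) cΛ) cE₂ cB Tc vh₂S (mixFFAt (toSite r) Lc) j))) j) + (((lin4 (cE₂ * (Lc : ℝ) ^ (2 * (d + 1))) (unitK (sfStep Lc j) (smStep d Lc j) (coDressKBmAt (toSite r) Lc (KInvStep (d := d) Lc j))) Lc
            (unitS₂ (sfStep Lc j) (smStep d Lc j) (T2RecOf d Lc (fun j => KInvStep (d := d) Lc j) (SpureRecAt d Lc (toSite r) cE cVH cΛ) (M1At d Lc (toSite r) cΛ) cE₂ cB Tc vh₂S (mixFFAt (toSite r) Lc) j)) -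
          lin4 (cE₂ * (Lc : ℝ) ^ (2 * (d + 1))) (unitK (sfStep Lc j) (smStep d Lc j) (KInvStep (d := d) Lc j)) Lc
            (unitS₂ (sfStep Lc j) (smStep d Lc j) (T2RecOf d Lc (fun j => KInvStep (d := d) Lc j) (SpureRecAt d Lc (toSite r) cE cVH cΛ) (M1At d Lc (toSite r) cΛ) cE₂ cB Tc vh₂S (mixFFAt (toSite r) Lc) j))) +
        ((fun κ u κ' u' => (cE₂ * (Lc : ℝ) ^ (2 * (d + 1))) • mmRead Lc (K3OfK (unitK (sfStep Lc j) (smStep d Lc j) (coDressKBmAt (toSite r) Lc (KInvStep (d := d) Lc j))) Lc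
            (unitS (sfStep Lc j) (smStep d Lc j) (SpureRecAt d Lc (toSite r) cE cVH cΛ j)) (unitM (sfStep Lc j) (smStep d Lc j) (M1At d Lc (toSite r) cΛ j))
            (W2SymOfK (unitK (sfStep Lc j) (smStep d Lc j) (coDressKBmAt (toSite r) Lc (KInvStep (d := d) Lc j))) Lc (unitS (sfStep Lc j) (smStep d Lc j) (SpureRecAt d Lc (toSite r) cE cVH cΛ j))
              (unitM (sfStep Lc j) (smStep d Lc j) (M1At d Lc (toSite r) cΛ j)) 0 (unitM₂ (sfStep Lc j) (smStep d Lc j) (M2Of d Lc (mixFFAt (toSite r) Lc) j))) κ u κ' u')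
          + cB • vh₂S κ u κ' u') -
         (fun κ u κ' u' => (cE₂ * (Lc : ℝ) ^ (2 * (d + 1))) • mmRead Lc (K3OfK (unitK (sfStep Lc j) (smStep d Lc j) (KInvStep (d := d) Lc j)) Lc
            (unitS (sfStep Lc j) (smStep d Lc j) (SpureRecAt d Lc (toSite r) cE cVH cΛ j)) (unitM (sfStep Lc j) (smStep d Lc j) (M1At d Lc (toSite r) cΛ j))
            (W2SymOfK (unitK (sfStep Lc j) (smStep d Lc j) (KInvStep (d := d) Lc j)) Lc (unitS (sfStep Lc j) (smStep d Lc j) (SpureRecAt d Lc (toSite r) cE cVH cΛ j))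
              (unitM (sfStep Lc j) (smStep d Lc j) (M1At d Lc (toSite r) cΛ j)) 0 (unitM₂ (sfStep Lc j) (smStep d Lc j) (M2Of d Lc (mixFFAt (toSite r) Lc) j))) κ u κ' u')
          + cB • vh₂S κ u κ' u')))) := by
  obtain ⟨C, C', δ, hδ, hE, hK⟩ := exists_locStencil₂_towers hLc hr cE cVH cΛ cE₂ cB Tc hB j
  obtain ⟨m, CK, hm, -, hKd⟩ := decays_coDressKBmAt_KInvStep (d := d) hr j
  have hKu := decays_unitK (sf := sfStep Lc j) (sm := smStep d Lc j) hKd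
  have hbE := bdd₄_of_locStencil₂ hE hδ.le
  have hbK := bdd₄_of_locStencil₂ hK hδ.le
  -- 𝒜^E_j T̃_j = 𝒜^E_j (T̃_j − T_j) + 𝒜^E_j T_j
  have hsplit : lin4 (cE₂ * (Lc : ℝ) ^ (2 * (d + 1))) (unitK (sfStep Lc j) (smStep d Lc j) (coDressKBmAt (toSite r) Lc (KInvStep (d := d) Lc j))) Lc (unitS₂ (sfStep Lc j) (smStep d Lc j) (T2RecAt d Lc (toSite r) cE cVH cΛ cE₂ cB Tc vh₂S (mixFFAt (toSite r) Lc) j))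
      = lin4 (cE₂ * (Lc : ℝ) ^ (2 * (d + 1))) (unitK (sfStep Lc j) (smStep d Lc j) (coDressKBmAt (toSite r) Lc (KInvStep (d := d) Lc j))) Lc ((unitS₂ (sfStep Lc j) (smStep d Lc j) (T2RecAt d Lc (toSite r) cE cVH cΛ cE₂ cB Tc vh₂S (mixFFAt (toSite r) Lc) j)) - (unitS₂ (sfStep Lc j) (smStep d Lc j) (T2RecOf d Lc (fun j => KInvStep (d := d) Lc j) (SpureRecAt d Lc (toSite r) cE cVH cΛ) (M1At d Lc (toSite r) cΛ) cE₂ cB Tc vh₂S (mixFFAt (toSite r) Lc) j)))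
        + lin4 (cE₂ * (Lc : ℝ) ^ (2 * (d + 1))) (unitK (sfStep Lc j) (smStep d Lc j) (coDressKBmAt (toSite r) Lc (KInvStep (d := d) Lc j))) Lc (unitS₂ (sfStep Lc j) (smStep d Lc j) (T2RecOf d Lc (fun j => KInvStep (d := d) Lc j) (SpureRecAt d Lc (toSite r) cE cVH cΛ) (M1At d Lc (toSite r) cΛ) cE₂ cB Tc vh₂S (mixFFAt (toSite r) Lc) j)) := by
    rw [← lin4_add_of_bdd₄ hKu hm _ Lc (bdd₄_sub hbE hbK) hbK, sub_add_cancel]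
  show (unitS₂ (sfStep Lc (j + 1)) (smStep d Lc (j + 1)) (T2RecAt d Lc (toSite r) cE cVH cΛ cE₂ cB Tc vh₂S (mixFFAt (toSite r) Lc) (j + 1))) - (unitS₂ (sfStep Lc (j + 1)) (smStep d Lc (j + 1)) (T2RecOf d Lc (fun j => KInvStep (d := d) Lc j) (SpureRecAt d Lc (toSite r) cE cVH cΛ) (M1At d Lc (toSite r) cΛ) cE₂ cB Tc vh₂S (mixFFAt (toSite r) Lc) (j + 1))) = _
  rw [succ_comb_dressed hLc hr cE cVH cΛ cE₂ cB Tc hBff hBmm hB j, succ_comb_undressed hLc hr cE cVH cΛ cE₂ cB Tc hBff hBmm hB j, hsplit]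
  abel

/-! ## §5 The exact CHARGE LEDGER of the deviation tower (no hypothesis beyond the border's shape and covariance) -/

/-- NOT IN PRINT; OUR BOOKKEEPING ([folklore] `dev_comb_succ` + leaf-19's `zmode_add` + this lineage's `DressedStepCharge.zmode_lin4_dressed_step`).  **THE DEVIATION's CHARGE STEP, EXACT**:
at every read-out period `N` and every level `j`,
`zmode N (D_{j+1}) μ ν ff = N^{d+1}·(c₄·(½·((Lc^{d+2})⁻¹)^4))·(zmode Lc (𝔇 D_j) μ ν ff + zmode Lc (𝔇 D_j) ν μ ff) + zmode N (g′_j) μ ν ff` — the DRESSED step reads the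
bond-symmetrised cell charge of the DRESSED deviation `𝔇 D_j` (leaf-02 g52's four-face charge `Lc⁴·fourFace_{Lc}(D_j)`), the forcing adds its own; with the OWNER's R4 numbers
(`Z(g′_1) = −Z(𝒜^E_1 D_1) ≠ 0`) the two terms cancel ONLY in the sum — this identity is where that cancellation lives in the tree. -/
theorem zmode_dev_succ (hLc : 1 ≤ Lc) (hr : r ∈ box (d + 1) Lc) (cE cVH cΛ cE₂ cB : ℝ) (Tc : Fin 4 → Fin 4 → Fin 4 → Fin 4 → ℝ)
    {vh₂S : Tab d}
    (hBff : ∀ κ u κ' u' x z (α β : Fin (d + 1)), vh₂S κ u κ' u' x z (Sum.inl α) (Sum.inl β) = 0)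
    (hBmm : ∀ κ u κ' u' x z (μ ν : Fin (d + 1)), vh₂S κ u κ' u' x z (Sum.inr μ) (Sum.inr ν) = 0)
    (hB : ∃ C δ : ℝ, 0 < δ ∧ LocStencil₂ vh₂S C δ)
    (hBt : ∀ (κ : Fin (d + 1)) (u : Fin (d + 1) → ℤ) (κ' : Fin (d + 1)) (u' t : Fin (d + 1) → ℤ),
      vh₂S κ (u + (Lc : ℤ) • t) κ' (u' + (Lc : ℤ) • t) = shiftK (-((Lc : ℤ) • t)) (vh₂S κ u κ' u')) (N j : ℕ) (μ ν α β : Fin (d + 1)) :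
    zmode N ((fun j => (unitS₂ (sfStep Lc j) (smStep d Lc j) (T2RecAt d Lc (toSite r) cE cVH cΛ cE₂ cB Tc vh₂S (mixFFAt (toSite r) Lc) j))
      - (unitS₂ (sfStep Lc j) (smStep d Lc j) (T2RecOf d Lc (fun j => KInvStep (d := d) Lc j) (SpureRecAt d Lc (toSite r) cE cVH cΛ) (M1At d Lc (toSite r) cΛ) cE₂ cB Tc vh₂S (mixFFAt (toSite r) Lc) j))) (j + 1)) μ ν (Sum.inl α) (Sum.inl β)
      = ((N : ℝ) ^ (d + 1)) * ((cE₂ * (Lc : ℝ) ^ (2 * (d + 1))) * ((1 / 2 : ℝ) * (((Lc : ℝ) ^ (d + 1 + 1))⁻¹) ^ 4) *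
          (zmode Lc (fun κ u κ' u' => dressKBmAt (toSite r) Lc (coProjBmAtK (toSite r) Lc
            (fun κ₁ u₁ => coProjBmAtK (toSite r) Lc ((fun j => (unitS₂ (sfStep Lc j) (smStep d Lc j) (T2RecAt d Lc (toSite r) cE cVH cΛ cE₂ cB Tc vh₂S (mixFFAt (toSite r) Lc) j))
      - (unitS₂ (sfStep Lc j) (smStep d Lc j) (T2RecOf d Lc (fun j => KInvStep (d := d) Lc j) (SpureRecAt d Lc (toSite r) cE cVH cΛ) (M1At d Lc (toSite r) cΛ) cE₂ cB Tc vh₂S (mixFFAt (toSite r) Lc) j))) j κ₁ u₁) κ' u') κ u)) μ ν (Sum.inl α) (Sum.inl β)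
            + zmode Lc (fun κ u κ' u' => dressKBmAt (toSite r) Lc (coProjBmAtK (toSite r) Lc
            (fun κ₁ u₁ => coProjBmAtK (toSite r) Lc ((fun j => (unitS₂ (sfStep Lc j) (smStep d Lc j) (T2RecAt d Lc (toSite r) cE cVH cΛ cE₂ cB Tc vh₂S (mixFFAt (toSite r) Lc) j))
      - (unitS₂ (sfStep Lc j) (smStep d Lc j) (T2RecOf d Lc (fun j => KInvStep (d := d) Lc j) (SpureRecAt d Lc (toSite r) cE cVH cΛ) (M1At d Lc (toSite r) cΛ) cE₂ cB Tc vh₂S (mixFFAt (toSite r) Lc) j))) j κ₁ u₁) κ' u') κ u)) ν μ (Sum.inl α) (Sum.inl β)))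
        + zmode N (((lin4 (cE₂ * (Lc : ℝ) ^ (2 * (d + 1))) (unitK (sfStep Lc j) (smStep d Lc j) (coDressKBmAt (toSite r) Lc (KInvStep (d := d) Lc j))) Lc
            (unitS₂ (sfStep Lc j) (smStep d Lc j) (T2RecOf d Lc (fun j => KInvStep (d := d) Lc j) (SpureRecAt d Lc (toSite r) cE cVH cΛ) (M1At d Lc (toSite r) cΛ) cE₂ cB Tc vh₂S (mixFFAt (toSite r) Lc) j)) -
          lin4 (cE₂ * (Lc : ℝ) ^ (2 * (d + 1))) (unitK (sfStep Lc j) (smStep d Lc j) (KInvStep (d := d) Lc j)) Lc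
            (unitS₂ (sfStep Lc j) (smStep d Lc j) (T2RecOf d Lc (fun j => KInvStep (d := d) Lc j) (SpureRecAt d Lc (toSite r) cE cVH cΛ) (M1At d Lc (toSite r) cΛ) cE₂ cB Tc vh₂S (mixFFAt (toSite r) Lc) j))) +
        ((fun κ u κ' u' => (cE₂ * (Lc : ℝ) ^ (2 * (d + 1))) • mmRead Lc (K3OfK (unitK (sfStep Lc j) (smStep d Lc j) (coDressKBmAt (toSite r) Lc (KInvStep (d := d) Lc j))) Lc
            (unitS (sfStep Lc j) (smStep d Lc j) (SpureRecAt d Lc (toSite r) cE cVH cΛ j)) (unitM (sfStep Lc j) (smStep d Lc j) (M1At d Lc (toSite r) cΛ j))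
            (W2SymOfK (unitK (sfStep Lc j) (smStep d Lc j) (coDressKBmAt (toSite r) Lc (KInvStep (d := d) Lc j))) Lc (unitS (sfStep Lc j) (smStep d Lc j) (SpureRecAt d Lc (toSite r) cE cVH cΛ j))
              (unitM (sfStep Lc j) (smStep d Lc j) (M1At d Lc (toSite r) cΛ j)) 0 (unitM₂ (sfStep Lc j) (smStep d Lc j) (M2Of d Lc (mixFFAt (toSite r) Lc) j))) κ u κ' u')
          + cB • vh₂S κ u κ' u') -
         (fun κ u κ' u' => (cE₂ * (Lc : ℝ) ^ (2 * (d + 1))) • mmRead Lc (K3OfK (unitK (sfStep Lc j) (smStep d Lc j) (KInvStep (d := d) Lc j)) Lc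
            (unitS (sfStep Lc j) (smStep d Lc j) (SpureRecAt d Lc (toSite r) cE cVH cΛ j)) (unitM (sfStep Lc j) (smStep d Lc j) (M1At d Lc (toSite r) cΛ j))
            (W2SymOfK (unitK (sfStep Lc j) (smStep d Lc j) (KInvStep (d := d) Lc j)) Lc (unitS (sfStep Lc j) (smStep d Lc j) (SpureRecAt d Lc (toSite r) cE cVH cΛ j))
              (unitM (sfStep Lc j) (smStep d Lc j) (M1At d Lc (toSite r) cΛ j)) 0 (unitM₂ (sfStep Lc j) (smStep d Lc j) (M2Of d Lc (mixFFAt (toSite r) Lc) j))) κ u κ' u')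
          + cB • vh₂S κ u κ' u')))) μ ν (Sum.inl α) (Sum.inl β) := by
  obtain ⟨CD, δD, hδD, hD⟩ := exists_locStencil₂_dev_comb hLc hr cE cVH cΛ cE₂ cB Tc hB j
  obtain ⟨CA, δA, hδA, -, hA⟩ := locStencil₂_lin4_dressed hr j (cE₂ * (Lc : ℝ) ^ (2 * (d + 1))) hD hδD
  obtain ⟨Cg, δg, hδg, hg⟩ := exists_locStencil₂_gprime_comb hLc hr cE cVH cΛ cE₂ cB Tc hBff hBmm hB j
  have hr' : 0 < min δA δg := lt_min hδA hδg
  rw [dev_comb_succ hLc hr cE cVH cΛ cE₂ cB Tc hBff hBmm hB j]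
  have e1 := zmode_add (N := N) (hA.mono (min_le_left _ _)) (hg.mono (min_le_right _ _)) hr' μ ν (Sum.inl α) (Sum.inl β)
  have e2 := zmode_lin4_dressed_step hr N j (cE₂ * (Lc : ℝ) ^ (2 * (d + 1))) hD hδD
    (fun κ u κ' u' t => dev_comb_translate hLc cE cVH cΛ cE₂ cB Tc hBt j κ u κ' u' t) μ ν α β
  -- `Pi` spelling versus the lambda spelling of `zmode_add`: definitionally equal
  have e1' : zmode N (lin4 (cE₂ * (Lc : ℝ) ^ (2 * (d + 1))) (unitK (sfStep Lc j) (smStep d Lc j) (coDressKBmAt (toSite r) Lc (KInvStep (d := d) Lc j))) Lc ((fun j => (unitS₂ (sfStep Lc j) (smStep d Lc j) (T2RecAt d Lc (toSite r) cE cVH cΛ cE₂ cB Tc vh₂S (mixFFAt (toSite r) Lc) j))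
      - (unitS₂ (sfStep Lc j) (smStep d Lc j) (T2RecOf d Lc (fun j => KInvStep (d := d) Lc j) (SpureRecAt d Lc (toSite r) cE cVH cΛ) (M1At d Lc (toSite r) cΛ) cE₂ cB Tc vh₂S (mixFFAt (toSite r) Lc) j))) j) + (((lin4 (cE₂ * (Lc : ℝ) ^ (2 * (d + 1))) (unitK (sfStep Lc j) (smStep d Lc j) (coDressKBmAt (toSite r) Lc (KInvStep (d := d) Lc j))) Lc
            (unitS₂ (sfStep Lc j) (smStep d Lc j) (T2RecOf d Lc (fun j => KInvStep (d := d) Lc j) (SpureRecAt d Lc (toSite r) cE cVH cΛ) (M1At d Lc (toSite r) cΛ) cE₂ cB Tc vh₂S (mixFFAt (toSite r) Lc) j)) -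
          lin4 (cE₂ * (Lc : ℝ) ^ (2 * (d + 1))) (unitK (sfStep Lc j) (smStep d Lc j) (KInvStep (d := d) Lc j)) Lc
            (unitS₂ (sfStep Lc j) (smStep d Lc j) (T2RecOf d Lc (fun j => KInvStep (d := d) Lc j) (SpureRecAt d Lc (toSite r) cE cVH cΛ) (M1At d Lc (toSite r) cΛ) cE₂ cB Tc vh₂S (mixFFAt (toSite r) Lc) j))) +
        ((fun κ u κ' u' => (cE₂ * (Lc : ℝ) ^ (2 * (d + 1))) • mmRead Lc (K3OfK (unitK (sfStep Lc j) (smStep d Lc j) (coDressKBmAt (toSite r) Lc (KInvStep (d := d) Lc j))) Lc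
            (unitS (sfStep Lc j) (smStep d Lc j) (SpureRecAt d Lc (toSite r) cE cVH cΛ j)) (unitM (sfStep Lc j) (smStep d Lc j) (M1At d Lc (toSite r) cΛ j))
            (W2SymOfK (unitK (sfStep Lc j) (smStep d Lc j) (coDressKBmAt (toSite r) Lc (KInvStep (d := d) Lc j))) Lc (unitS (sfStep Lc j) (smStep d Lc j) (SpureRecAt d Lc (toSite r) cE cVH cΛ j))
              (unitM (sfStep Lc j) (smStep d Lc j) (M1At d Lc (toSite r) cΛ j)) 0 (unitM₂ (sfStep Lc j) (smStep d Lc j) (M2Of d Lc (mixFFAt (toSite r) Lc) j))) κ u κ' u')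
          + cB • vh₂S κ u κ' u') -
         (fun κ u κ' u' => (cE₂ * (Lc : ℝ) ^ (2 * (d + 1))) • mmRead Lc (K3OfK (unitK (sfStep Lc j) (smStep d Lc j) (KInvStep (d := d) Lc j)) Lc
            (unitS (sfStep Lc j) (smStep d Lc j) (SpureRecAt d Lc (toSite r) cE cVH cΛ j)) (unitM (sfStep Lc j) (smStep d Lc j) (M1At d Lc (toSite r) cΛ j))
            (W2SymOfK (unitK (sfStep Lc j) (smStep d Lc j) (KInvStep (d := d) Lc j)) Lc (unitS (sfStep Lc j) (smStep d Lc j) (SpureRecAt d Lc (toSite r) cE cVH cΛ j))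
              (unitM (sfStep Lc j) (smStep d Lc j) (M1At d Lc (toSite r) cΛ j)) 0 (unitM₂ (sfStep Lc j) (smStep d Lc j) (M2Of d Lc (mixFFAt (toSite r) Lc) j))) κ u κ' u')
          + cB • vh₂S κ u κ' u'))))) μ ν (Sum.inl α) (Sum.inl β) = _ := e1
  rw [e1', e2]

/-- [folklore] **THE DEVIATION IS CHARGE-FREE AT LEVEL `j` IFF THE TOWER's CHARGE IS CONSERVED RELATIVE TO THE UNDRESSED-KERNEL TOWER THERE**:
`zmode N (D_j) μ ν ff = 0 ↔ zmode N (T̃_j) μ ν ff = zmode N (T_j) μ ν ff` (leaf-19's `zmode_sub`) — the OWNER's conservation law (C) of RULING R-gan24p1-g23-3 (ii), read on the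
deviation; with `zmode_dev_succ` it says `zmode N (g′_j) = −N^{d+1}·c₄·½σ⁴·zmodeSym_{Lc}(𝔇 D_j)` level by level (R4: «compensated ONLY in the total»). (C) itself is an2's. -/
theorem zmode_dev_eq_zero_iff_conserved (hLc : 1 ≤ Lc) (hr : r ∈ box (d + 1) Lc) (cE cVH cΛ cE₂ cB : ℝ) (Tc : Fin 4 → Fin 4 → Fin 4 → Fin 4 → ℝ)
    {vh₂S : Tab d} (hB : ∃ C δ : ℝ, 0 < δ ∧ LocStencil₂ vh₂S C δ) (N j : ℕ) (μ ν α β : Fin (d + 1)) :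
    zmode N ((fun j => (unitS₂ (sfStep Lc j) (smStep d Lc j) (T2RecAt d Lc (toSite r) cE cVH cΛ cE₂ cB Tc vh₂S (mixFFAt (toSite r) Lc) j))
      - (unitS₂ (sfStep Lc j) (smStep d Lc j) (T2RecOf d Lc (fun j => KInvStep (d := d) Lc j) (SpureRecAt d Lc (toSite r) cE cVH cΛ) (M1At d Lc (toSite r) cΛ) cE₂ cB Tc vh₂S (mixFFAt (toSite r) Lc) j))) j) μ ν (Sum.inl α) (Sum.inl β) = 0 ↔
      zmode N (unitS₂ (sfStep Lc j) (smStep d Lc j) (T2RecAt d Lc (toSite r) cE cVH cΛ cE₂ cB Tc vh₂S (mixFFAt (toSite r) Lc) j)) μ ν (Sum.inl α) (Sum.inl β)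
        = zmode N (unitS₂ (sfStep Lc j) (smStep d Lc j) (T2RecOf d Lc (fun j => KInvStep (d := d) Lc j) (SpureRecAt d Lc (toSite r) cE cVH cΛ) (M1At d Lc (toSite r) cΛ) cE₂ cB Tc vh₂S (mixFFAt (toSite r) Lc) j)) μ ν (Sum.inl α) (Sum.inl β) := by
  obtain ⟨C, C', δ, hδ, hE, hK⟩ := exists_locStencil₂_towers hLc hr cE cVH cΛ cE₂ cB Tc hB j
  have e := zmode_sub (N := N) hE hK hδ μ ν (Sum.inl α) (Sum.inl β)
  have e' : zmode N ((fun j => (unitS₂ (sfStep Lc j) (smStep d Lc j) (T2RecAt d Lc (toSite r) cE cVH cΛ cE₂ cB Tc vh₂S (mixFFAt (toSite r) Lc) j))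
      - (unitS₂ (sfStep Lc j) (smStep d Lc j) (T2RecOf d Lc (fun j => KInvStep (d := d) Lc j) (SpureRecAt d Lc (toSite r) cE cVH cΛ) (M1At d Lc (toSite r) cΛ) cE₂ cB Tc vh₂S (mixFFAt (toSite r) Lc) j))) j) μ ν (Sum.inl α) (Sum.inl β) = _ := e
  rw [e', sub_eq_zero]

end Summit.QuantumFields.BalabanUV.Beta.GAN24.T2DevShapes

end
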